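import Summits.BirchSwinnertonDyer.BirchSwinnertonDyer.Theorems.KatoDescentPotSupersingularReducibleHullShaBound
import Summits.BirchSwinnertonDyer.Rank1Residual.X12.O11.LocalKernelFiniteAtThreeDischarge
import HarnessLib

/-!
# THE `λ`-EXACT `J`-ROAD FOR CRUX M (item 19196), ALL ROWS: with Kato's hull data, the `J`-package of H2X and the ONE-SIDED
# level-0 count `#Sel_str·#W(ℚ_v)[p^∞] ∣ #(J.H2)_Γ·#W(ℚ)[p^∞]` ((14.14.2) + (14.9.3) for `J`, one direction):
# `ord_p #Ш(W)[p^∞] + v_p(Tam W) ≤ ord_p(L(W,1)/Ω(W)) + 2·v_p #W(ℚ)_tors + t₀ ≤ … + 3·v_p #W(ℚ)_tors` — NO `W(ℚ_p)[p] = 0` hypothesis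

Seat `bsd-potss-rkm` g29 (prover, cell `bsd-potss`), item stmt-BirchSwinnertonDyer-19196 `ReducibleKatoMember` = crux M of
K9 `KatoDescentPotSupersingular` (support) / K8-t′ `KatoDescentTamePotSupersingular` (auto-crux); `--supports … --as helper`;
route-free; closes nothing.  HONEST FRAMING: BSD is proved for no curve by this file; nothing is booked; crux M stays cite-level
on {modularity, HELD 27962 `Kato2004.exists_memberHullZetaCoreInputs`}; theorems only.

The prequels close crux M's inequality (slack 2) on the rows with `W(ℚ_p)[p] = 0` from the hull sub-package of 27962 + {H2X, FW, Lim 3.5}.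
On the other reducible rows (168/632 non-CM r0 O5 class reps at `p = 5`, kit j319232; 5823/9476 of K9's X3 ∧ O6 ∧ r0 reps at `p = 3`,
kit j319256) exact fine control is unavailable and the local term `t_p = ord_p #W(ℚ_v)[p^∞]` does not cancel on the one-sided road.  What cancels it in print is (14.14.2)
`𝐇²_Γ/(γ−1) ≅ H²(ℤ[1/p],T)` with the Poitou–Tate count of `H²(ℤ[1/p],T)` ((14.9.3)): `#(𝐇²_Γ)_Γ · #W(ℚ)[p^∞] = #Sel_str(ℚ,W[p^∞]) · #W(ℚ_v)[p^∞]`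
— clause (c2′) of 27962, there pinned to the package's ABSTRACT `H2`.  THIS FILE shows that ONE DIRECTION of (c2′), PINNED TO THE `J` OF H2X
(`#Sel_str · #W(ℚ_v)[p^∞] ∣ #(J.H2)_Γ · #W(ℚ)[p^∞]`), is all the hull road needs on EVERY reducible row:

* §6 `valuation_add_padicValNat_coinvariants_H2_le_index_of_hull` — the raw hull count on `J.H2`: `v_p(λ(0)) + ord #(J.H2)_Γ ≤ ord [A : ℤ_p y₀]`.
* §7 **`padicValNat_sha_add_tamagawa_add_valuation_le_of_zetaLineOrthIndexAt_of_hull_of_countDvd`** — hull data + `J ⊇ X₀` + the one-sided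
  count + (b′)(e): **`ord Ш[p^∞] + v Tam + v(λ(0)) + t_p ≤ e + v(c_p) + 2·v tors + t₀`** (`t₀ = ord_p #W(ℚ)[p^∞]`); modulo {FW, Lim 3.5} and
  the displayed package (no H2X binder: `J`, `e_X` are explicit, since the count refers to `J`).
* §8 **`…_normalForm_of_countDvd`**: with 27962's printed exponent `e = ord_p q + v_p(λ(0)) + t_p − v_p(c_p)`:
  **`ord_p #Ш(W)[p^∞] + v_p(Tam W) ≤ ord_p q + 2·v_p #W(ℚ)_tors + t₀ ≤ ord_p q + 3·v_p #W(ℚ)_tors`** — crux M's printed inequality AT `W`,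
  on EVERY reducible row (`p ≠ 2`), wild `p = 3` with `W(ℚ_3)[3] ≠ 0` included.
* §9 `countDvd_of_noPTorsionPadic` — on the rows with `W(ℚ_p)[p] = 0` the one-sided count IS KERNEL for every `J ⊇ X₀` of finite cokernel
  (exact control + the prequel's `ord #(X₀)_Γ ≤ ord #(J.H2)_Γ`): §7–§8 contain the prequels' tame theorems.

READING (planner, R294 and the K9 twin).  The uniform honest carving of 27962 for ALL reducible non-CM rows of M is: HULL SUB-PACKAGE (11 fields)
⊕ H2X⁺, where H2X⁺ := H2X with the one-sided count clause for ITS `J` ((14.14.2) + (14.9.3), Kato pp. 240, 243; print for Kato's `𝐇²`, whose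
`J` H2X transcribes) — a one-clause sharpening of an existing reviewed fact, typeable in `Kato2004/IwasawaH2FineSelmerDualComparison`'s sequel;
on the tame rows the extra clause is kernel (§9).  CM rows: `…ReducibleKatoMemberCMRows`.

References: [Kato2004Asterisque] Thm. 12.5–12.6, Lemma 13.10 (1), 13.14, Thm. 14.5, (14.9.1)–(14.9.3), §14.14–14.15, Prop. 14.16 (2),
Lemma 14.18; [Kim2022StructureSelmer] §3.2.3; [MilneADT2006] I Cor. 2.3, Thm. 4.10 (b); [GreenbergLNM1716] §4 Lemma 4.2.
-/

-- the summit and its single problem are both named `BirchSwinnertonDyer` (registry layout D-0017)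
set_option linter.dupNamespace false
set_option autoImplicit false

noncomputable section

open scoped Classical NumberField TensorProduct
open Function Field NumberField IsDedekindDomain WeierstrassCurve CongruenceSubgroup
open Literature.NumberTheory.EllipticCurves Literature.NumberTheory.EllipticCurves.GreenbergSelmer
open Literature.NumberTheory.GaloisRepresentations
open Literature.NumberTheory.EllipticCurves.ModularForms
open Literature.NumberTheory.EllipticCurves.Kato2004 Literature.NumberTheory.EllipticCurves.Kato2004.EulerSystemValues
open Literature.NumberTheory.EllipticCurves.IwasawaAlgebra Literature.NumberTheory.EllipticCurves.IwasawaDual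
open Literature.NumberTheory.GaloisRepresentations.DiscreteGaloisModule Literature.NumberTheory.GaloisCohomology
open Literature.NumberTheory.EllipticCurves.Rank1Residual
open Summit.BirchSwinnertonDyer.Rank1Residual
open Summit.BirchSwinnertonDyer.Rank1Residual.X11b.Levels Summit.BirchSwinnertonDyer.Rank1Residual.X11b.LocBridge
  Summit.BirchSwinnertonDyer.Rank1Residual.X11b.AcSelmer
open Summit.BirchSwinnertonDyer.BirchSwinnertonDyer.Theorems
open Summit.BirchSwinnertonDyer.BirchSwinnertonDyer.Theorems.ASideJunction
open Summit.BirchSwinnertonDyer.BirchSwinnertonDyer.Theorems.KatoFiniteLevelCount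
open Summit.BirchSwinnertonDyer.BirchSwinnertonDyer.Theorems.StrictSelmerBridge
open Summit.BirchSwinnertonDyer.BirchSwinnertonDyer.Theorems.IntegralH1LayerZeroTop

universe u

namespace Summit.BirchSwinnertonDyer.BirchSwinnertonDyer.Theorems.ReducibleHullDescentCount

/-! ## §6 The raw hull count on `J.H2` -/

section RawHull

variable (W : WeierstrassCurve ℚ) [W.IsElliptic] (p : ℕ) [Fact p.Prime]
  [ContinuousSMul ℤ_[p] (W.tateModule p)]
  [Finite W.toAffine.Point] [Finite (AddCommGroup.primaryComponent W.sha p)]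
  {κ : ZpExtension ℚ p} {γ : absoluteGaloisGroup ℚ}

/-- **`v_p(λ(0)) + ord_p #(J.H2)_Γ ≤ ord_p [H¹(ℤ[1/p],T_pW) : ℤ_p·y₀]`** — seat g3's hull descent run on the `𝐇²`-package `J` of H2X
(`X₀ ↪ J.H2` finite cokernel), for ANY class `y` with `y₀` of infinite order and hull data `(F, j, z, λ)` with `j y = λ·z` and Thm. 12.5 (3)
for `z` read against `X₀` off `(p)`; `W[p]` reducible (`μ(X₀) = 0` by FW + Lim 3.5).  `(J.H2)_Γ` and the index are finite.
[cite: Kato2004Asterisque, Thm. 12.5 (3) (p. 222), Lemma 13.10 (1) (p. 230), 13.14 (p. 234), §14.14 (14.14.1) and Lemma 14.15 (pp. 243–244)]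
[cite: GreenbergLNM1716, §4 Lemma 4.2 (p. 102)] -/
theorem valuation_add_padicValNat_coinvariants_H2_le_index_of_hull
    (hLim : Lim2017.thm35_fineSelmerDual_moduleFinite_of_classicalMuVanishes_of_le_divisionField)
    (hFW : Literature.NumberTheory.IwasawaTheory.ferreroWashington1979_classicalMuVanishes)
    (hp : p ≠ 2) (hκ : κ.IsCyclotomic) (hγ : κ.IsTopGenerator γ) (hred : ¬ W.HasIrreducibleModPGaloisRep p)
    (I : IwasawaH1Data W p κ γ) (J : IwasawaH2Data W p κ γ I)
    (eX : (W.fineSelmerDualData κ hγ).X →ₗ[IwasawaAlgebra p] J.H2) (heX : Function.Injective eX)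
    (hcokX : Finite (J.H2 ⧸ LinearMap.range eX))
    {F : Type} [AddCommGroup F] [Module (IwasawaAlgebra p) F] [Module.Finite (IwasawaAlgebra p) F]
    [NoZeroSMulDivisors (IwasawaAlgebra p) F]
    (j : I.H →ₗ[IwasawaAlgebra p] F) (hj : Function.Injective j) (hcok : Finite (F ⧸ LinearMap.range j))
    (z : F) (hz : z ≠ 0) (hFZ : Module.IsTorsion (IwasawaAlgebra p) (F ⧸ (IwasawaAlgebra p) ∙ z))
    (hdiv : ∀ 𝔮 : PrimeSpectrum (IwasawaAlgebra p), 𝔮.asIdeal.height = 1 → 𝔮.asIdeal ≠ augIdealP p →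
      Module.lengthAt (IwasawaAlgebra p) (W.fineSelmerDualData κ hγ).X 𝔮 ≤
        Module.lengthAt (IwasawaAlgebra p) (F ⧸ (IwasawaAlgebra p) ∙ z) 𝔮)
    (y : I.H) (lam : IwasawaAlgebra p) (hlam : PowerSeries.constantCoeff lam ≠ 0) (hjy : j y = lam • z)
    (hnt : ¬ IsOfFinAddOrder (I.proj 0 y)) :
    Finite (coinvariants p J.H2) ∧
      Finite (integralH1 (tateRep W p) p (κ.layerSubgroup 0) ⧸
        Submodule.span ℤ_[p] {(⟨I.proj 0 y, I.proj_mem 0 y⟩ : integralH1 (tateRep W p) p (κ.layerSubgroup 0))}) ∧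
      (PowerSeries.constantCoeff lam).valuation + padicValNat p (Nat.card (coinvariants p J.H2)) ≤
        padicValNat p (Nat.card (integralH1 (tateRep W p) p (κ.layerSubgroup 0) ⧸
          Submodule.span ℤ_[p] {(⟨I.proj 0 y, I.proj_mem 0 y⟩ : integralH1 (tateRep W p) p (κ.layerSubgroup 0))})) := by
  -- `μ(X₀) = 0` on the reducible row
  have hA := ReducibleFineSelmerMuZero.fineSelmerDual_moduleFinite_of_not_irreducible hLim hFW W p hp hred κ hκ
  have hfinp : Set.Finite {t : W.fineSelmerInfty κ | p • t = 0} :=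
    (IwasawaModuleFinitePadicInt.exists_fineSelmerDualData_moduleFinite_iff_finite_pTorsion W κ hγ).mp hA
  haveI : Module.Finite (IwasawaAlgebra p) (W.fineSelmerDualData κ hγ).X :=
    (W.fineSelmerDualData κ hγ).module_finite_of_finite_pTorsion hγ hfinp
  haveI : Finite ((W.fineSelmerDualData κ hγ).X ⧸
      (IwasawaAlgebra.augIdealP p • (⊤ : Submodule (IwasawaAlgebra p) (W.fineSelmerDualData κ hγ).X))) :=
    (W.fineSelmerDualData κ hγ).finite_quotient_augIdealP_of_finite_pTorsion hfinp
  haveI : Module.Finite (IwasawaAlgebra p) I.H := IwasawaH1Data.module_finite_of_isCyclotomic hκ hγ I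
  haveI := I.noZeroSMulDivisors hγ
  haveI := J.finite_H2
  -- `ℓ_{(T)}(F/Λz) = 0`
  have hy0 : y ≠ 0 := by
    rintro rfl
    exact hnt (by rw [map_zero]; exact isOfFinAddOrder_iff_nsmul_eq_zero.mpr ⟨1, one_pos, by simp⟩)
  have htorsHy : Module.IsTorsion (IwasawaAlgebra p) (I.H ⧸ Submodule.span (IwasawaAlgebra p) {y}) :=
    ReducibleZetaDivisibility.isTorsion_quotient_span_singleton_of_ne_zero W p hκ hγ I hy0
  obtain ⟨-, hfinHy⟩ := ReducibleFineSelmerDescentCount.finite_coinvariants_quotient_span_of_not_isOfFinAddOrder hκ hγ I y hnt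
  have hTHy : Module.lengthAt (IwasawaAlgebra p) (I.H ⧸ Submodule.span (IwasawaAlgebra p) {y}) (primeT p) = 0 :=
    lengthAt_primeT_eq_zero_of_finite_coinvariants _ htorsHy hfinHy
  have hTFjy : Module.lengthAt (IwasawaAlgebra p) (F ⧸ (IwasawaAlgebra p) ∙ j y) (primeT p) = 0 := by
    rw [← lengthAt_quotient_span_eq_of_finite_coker j hj hcok y (primeT p) (le_of_eq (height_primeT p))]; exact hTHy
  have hTFz : Module.lengthAt (IwasawaAlgebra p) (F ⧸ (IwasawaAlgebra p) ∙ z) (primeT p) = 0 := by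
    have hle : ((IwasawaAlgebra p) ∙ j y) ≤ (IwasawaAlgebra p) ∙ z := by
      rw [hjy, Submodule.span_singleton_le_iff_mem]
      exact Submodule.smul_mem _ _ (Submodule.mem_span_singleton_self z)
    have h1 := Module.lengthAt_le_of_surjective (Submodule.factor hle) (Submodule.factor_surjective hle) (primeT p)
    rw [hTFjy] at h1
    exact le_antisymm h1 bot_le
  -- divisibility for `J.H2` at every height-one prime
  have hdivJ : ∀ 𝔮 : PrimeSpectrum (IwasawaAlgebra p), 𝔮.asIdeal.height = 1 →
      Module.lengthAt (IwasawaAlgebra p) J.H2 𝔮 ≤ Module.lengthAt (IwasawaAlgebra p) (F ⧸ (IwasawaAlgebra p) ∙ z) 𝔮 := by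
    intro 𝔮 h𝔮
    rw [← lengthAt_eq_of_injective_of_finite_quotient eX heX hcokX 𝔮 (le_of_eq h𝔮)]
    by_cases hq : 𝔮.asIdeal = augIdealP p
    · rw [Rank1Residual.KatoMuSkeleton.lengthAt_eq_zero_of_finite_quotient_p (M := (W.fineSelmerDualData κ hγ).X) 𝔮 hq]
      exact bot_le
    · exact hdiv 𝔮 h𝔮 hq
  have hTJ : Module.lengthAt (IwasawaAlgebra p) J.H2 (primeT p) = 0 :=
    le_antisymm ((hdivJ (primeT p) (height_primeT p)).trans (le_of_eq hTFz)) bot_le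
  obtain ⟨-, hfinJ, -⟩ := card_coinvariants_of_lengthAt_eq_zero J.H2 J.isTorsion_H2 hTJ
  haveI hfinIdx := ReducibleFineSelmerDescentCount.finite_quotient_span_of_not_isOfFinAddOrder I y hnt
  have hne : Nat.card (J.A ⧸ (IwasawaAlgebra p) ∙ J.ι (Submodule.Quotient.mk y)) ≠ 0 := by
    rw [natCard_quotient_ι_eq_index hκ hγ J y]; exact Nat.card_pos.ne'
  have hhull := Kato2004.valuation_add_padicValNat_coinvariants_le_of_hull_smul j hj hcok z hz hFZ J.isTorsion_H2 hdivJ y lam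
    hlam hjy J.ι J.π J.ι_injective J.π_surjective J.exact_ι_π hfinJ hne
  rw [natCard_quotient_ι_eq_index hκ hγ J y] at hhull
  exact ⟨hfinJ, hfinIdx, hhull⟩

end RawHull

/-! ## §7 The bound from the ONE-SIDED level-0 count pinned to `J` — every reducible row -/

section Count

variable (W : WeierstrassCurve ℚ) [W.IsElliptic] (p : ℕ) [Fact p.Prime]
  [ContinuousSMul ℤ_[p] (W.tateModule p)]
  [Finite W.toAffine.Point] [Finite (AddCommGroup.primaryComponent W.sha p)]
  {κ : ZpExtension ℚ p} {γ : absoluteGaloisGroup ℚ}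

/-- **CRUX M's inequality, `λ`-exact, modulo (b′) and the one-sided count for `J`, on EVERY reducible row** (`p ≠ 2`; no hypothesis at `p`).
Data: `W[p]` reducible, `W(ℚ)`, `Ш(W)[p^∞]` finite, `(κ,γ)` cyclotomic, pin `I`, a package `J` with `X₀ ↪ J.H2` of finite cokernel (H2X's content,
explicit), ANY `y` with `y₀` of infinite order, hull data `(F, j, z, λ)`, and the ONE-SIDED COUNT
`#Sel_str(ℚ,W[p^∞]) · #W(ℚ_v)[p^∞] ∣ #(J.H2)_Γ · #W(ℚ)[p^∞]` ((14.14.2) `(𝐇²)_Γ ≅ H²(ℤ[1/p],T)` + the Poitou–Tate count (14.9.3) of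
`H²(ℤ[1/p],T)`, one direction, pinned to `J`).  Then for every `e` with (b′):
**`ord_p #Ш(W)[p^∞] + v_p(Tam W) + v_p(λ(0)) + t_p ≤ e + v_p(c_p) + 2·v_p #W(ℚ)_tors + t₀`**, `t_p = ord_p #W(ℚ_v)[p^∞]`, `t₀ = ord_p #W(ℚ)[p^∞]`.
Modulo {FW, Lim 3.5}; Poitou–Tate over `ℚ` and the ledger of parts 39–58 are kernel theorems.
[cite: Kato2004Asterisque, Thm. 12.5 (3) (p. 222), Lemma 13.10 (1) (p. 230), (14.9.3) (p. 240), §14.14 (14.14.1)–(14.14.2) (p. 243), Prop. 14.16 (2) (pp. 244–245), Lemma 14.18 (pp. 247–248)]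
[cite: MilneADT2006, Ch. I, Cor. 2.3, Thm. 4.10 (b)] -/
theorem padicValNat_sha_add_tamagawa_add_valuation_le_of_zetaLineOrthIndexAt_of_hull_of_countDvd
    (hLim : Lim2017.thm35_fineSelmerDual_moduleFinite_of_classicalMuVanishes_of_le_divisionField)
    (hFW : Literature.NumberTheory.IwasawaTheory.ferreroWashington1979_classicalMuVanishes)
    (hp : p ≠ 2) (hκ : κ.IsCyclotomic) (hγ : κ.IsTopGenerator γ) (hred : ¬ W.HasIrreducibleModPGaloisRep p)
    (I : IwasawaH1Data W p κ γ) (J : IwasawaH2Data W p κ γ I)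
    (eX : (W.fineSelmerDualData κ hγ).X →ₗ[IwasawaAlgebra p] J.H2) (heX : Function.Injective eX)
    (hcokX : Finite (J.H2 ⧸ LinearMap.range eX))
    (hcount : Nat.card (katoStrictSelmer W p {primePlace p}) *
        Nat.card (AddCommGroup.primaryComponent (W.baseChange ((primePlace p).adicCompletion ℚ)).toAffine.Point p) ∣
      Nat.card (coinvariants p J.H2) * Nat.card (AddCommGroup.primaryComponent W.toAffine.Point p))
    {F : Type} [AddCommGroup F] [Module (IwasawaAlgebra p) F] [Module.Finite (IwasawaAlgebra p) F]
    [NoZeroSMulDivisors (IwasawaAlgebra p) F]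
    (j : I.H →ₗ[IwasawaAlgebra p] F) (hj : Function.Injective j) (hcok : Finite (F ⧸ LinearMap.range j))
    (z : F) (hz : z ≠ 0) (hFZ : Module.IsTorsion (IwasawaAlgebra p) (F ⧸ (IwasawaAlgebra p) ∙ z))
    (hdiv : ∀ 𝔮 : PrimeSpectrum (IwasawaAlgebra p), 𝔮.asIdeal.height = 1 → 𝔮.asIdeal ≠ augIdealP p →
      Module.lengthAt (IwasawaAlgebra p) (W.fineSelmerDualData κ hγ).X 𝔮 ≤
        Module.lengthAt (IwasawaAlgebra p) (F ⧸ (IwasawaAlgebra p) ∙ z) 𝔮)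
    (y : I.H) (lam : IwasawaAlgebra p) (hlam : PowerSeries.constantCoeff lam ≠ 0) (hjy : j y = lam • z)
    (hnt : ¬ IsOfFinAddOrder (I.proj 0 y))
    (e : ℕ) (hb : ZetaLineOrthIndexAt W p (layerZeroToTop W p κ (I.proj 0 y)) e) :
    padicValNat p (Nat.card (AddCommGroup.primaryComponent W.sha p)) + padicValNat p W.tamagawaProduct +
        (PowerSeries.constantCoeff lam).valuation +
        padicValNat p (Nat.card (AddCommGroup.primaryComponent (W.baseChange ((primePlace p).adicCompletion ℚ)).toAffine.Point p)) ≤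
      e + padicValNat p ((W.baseChange ((primePlace p).adicCompletion ℚ)).localTamagawaNumber
          ((primePlace p).adicCompletionIntegers ℚ)) + 2 * padicValNat p W.torsionOrder +
        padicValNat p (Nat.card (AddCommGroup.primaryComponent W.toAffine.Point p)) := by
  have hpp : p.Prime := Fact.out
  have hPT : poitouTate_selmerStructure_duality ℚ :=
    poitouTate_selmerStructure_duality_of_conj (InputsPoitouTateSelmer.poitouTate_selmerStructure_duality_conj_holds ℚ)
  -- §6
  obtain ⟨hfinJ, hfinIdx, hcountJ⟩ := valuation_add_padicValNat_coinvariants_H2_le_index_of_hull W p hLim hFW hp hκ hγ hred I J eX heX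
    hcokX j hj hcok z hz hFZ hdiv y lam hlam hjy hnt
  haveI := hfinJ
  haveI := hfinIdx
  haveI := Summit.BirchSwinnertonDyer.Rank1Residual.X12.O11.finite_primaryComponent_point_adicCompletion W p (primePlace p)
  -- the zeta line at `⊤`, the ledger
  set y₀ : H1 (tateRep W p) ⊤ := layerZeroToTop W p κ (I.proj 0 y) with hy₀def
  have hy₀ : y₀ ∈ integralH1 (tateRep W p) p ⊤ := layerZeroToTop_mem_integralH1 W p κ (I.proj_mem 0 y)
  have hrel := ReducibleTameShaBound.natCard_quotient_span_layerZero_eq_relIndex_top I y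
  have hidx0 : Nat.card (integralH1 (tateRep W p) p (κ.layerSubgroup 0) ⧸
      Submodule.span ℤ_[p] {(⟨I.proj 0 y, I.proj_mem 0 y⟩ : integralH1 (tateRep W p) p (κ.layerSubgroup 0))}) ≠ 0 :=
    Nat.card_pos.ne'
  have hrel0 : (ℤ_[p] ∙ y₀).toAddSubgroup.relIndex (integralH1 (tateRep W p) p ⊤).toAddSubgroup ≠ 0 := hrel ▸ hidx0
  obtain ⟨N, hN⟩ := exists_pow_smul_mem_span_singleton_of_relIndex_ne_zero (integralH1 (tateRep W p) p ⊤) y₀ hy₀ hrel0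
  obtain ⟨𝓢inf, hSp, hSur, hSinl⟩ : ∃ 𝓢 : SelmerStructure (primaryGaloisModule W p),
      𝓢 (Sum.inr (primePlace p)) = ⊥ ∧
      (∀ v : HeightOneSpectrum (𝓞 ℚ), v ≠ primePlace p →
        𝓢 (Sum.inr v) = unramifiedSubgroup (GaloisRep.toLocal v (primaryGaloisModule W p)) 1) ∧
      ∀ w : InfinitePlace ℚ, 𝓢 (Sum.inl w) = ⊤ :=
    ⟨fun v => match v with
      | Sum.inl _ => ⊤
      | Sum.inr v => if v = primePlace p then ⊥ else unramifiedSubgroup (GaloisRep.toLocal v (primaryGaloisModule W p)) 1,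
     if_pos rfl, fun v hv => if_neg hv, fun _ => rfl⟩
  obtain ⟨𝓤inf, hUp, hUur, hUinl⟩ : ∃ 𝓤 : SelmerStructure (primaryGaloisModule W p),
      𝓤 (Sum.inr (primePlace p)) = ⊤ ∧
      (∀ v : HeightOneSpectrum (𝓞 ℚ), v ≠ primePlace p →
        𝓤 (Sum.inr v) = unramifiedSubgroup (GaloisRep.toLocal v (primaryGaloisModule W p)) 1) ∧
      ∀ w : InfinitePlace ℚ, 𝓤 (Sum.inl w) = ⊤ :=
    ⟨fun v => match v with
      | Sum.inl _ => ⊤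
      | Sum.inr v => if v = primePlace p then ⊤ else unramifiedSubgroup (GaloisRep.toLocal v (primaryGaloisModule W p)) 1,
     if_pos rfl, fun v hv => if_neg hv, fun _ => rfl⟩
  obtain ⟨S, hS⟩ : ∃ S : Finset (HeightOneSpectrum (𝓞 ℚ)), ∀ v, v ∉ S → W.HasGoodReductionAt v := by
    have h := WeierstrassCurve.eventually_hasGoodReductionAt W
    rw [Filter.eventually_cofinite] at h
    exact ⟨h.toFinset, fun v hv => by_contra fun hbad => hv (h.mem_toFinset.mpr hbad)⟩
  have h58 := tamagawa_mul_sha_mul_index_le_ppart_of_zetaLineOrthIndexAt W p 𝓤inf 𝓢inf hPT hp (insert (primePlace p) S)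
    (Finset.mem_insert_self _ _) (fun v hv => hS v fun h => hv (Finset.mem_insert_of_mem h)) hUp hUur hUinl hSp hSur hSinl y₀ hy₀ N hN e hb
  have h59 : Nat.card 𝓢inf.selmerGroup = Nat.card (katoStrictSelmer W p {primePlace p}) :=
    natCard_selmerGroup_eq_natCard_katoStrictSelmer W p 𝓢inf hSp hSur hSinl
  rw [h59, ← hrel] at h58
  -- names and `p`-powers
  set idx := Nat.card (integralH1 (tateRep W p) p (κ.layerSubgroup 0) ⧸
      Submodule.span ℤ_[p] {(⟨I.proj 0 y, I.proj_mem 0 y⟩ : integralH1 (tateRep W p) p (κ.layerSubgroup 0))}) with hidx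
  set cS := Nat.card (katoStrictSelmer W p {primePlace p}) with hcS
  set n := Nat.card (coinvariants p J.H2) with hn
  obtain ⟨m, hm⟩ : ∃ m : ℕ, idx = p ^ m := MemberHullZetaInputsOfCore.natCard_eq_prime_pow_of_finite_module p ℤ_[p] _
  obtain ⟨ν, hν⟩ : ∃ ν : ℕ, n = p ^ ν := MemberHullZetaInputsOfCore.natCard_eq_prime_pow_of_finite_module p (IwasawaAlgebra p) _
  obtain ⟨s, hs⟩ := MemberHullZetaInputsOfCore.natCard_primaryComponent_eq_prime_pow p (G := ↥W.sha)
  obtain ⟨t₀, ht₀⟩ := MemberHullZetaInputsOfCore.natCard_primaryComponent_eq_prime_pow p (G := W.toAffine.Point)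
  obtain ⟨tp, htp⟩ := MemberHullZetaInputsOfCore.natCard_primaryComponent_eq_prime_pow p
    (G := (W.baseChange ((primePlace p).adicCompletion ℚ)).toAffine.Point)
  have hcount' : cS * p ^ tp ≤ p ^ ν * p ^ t₀ := by
    rw [← htp, ← hν, ← ht₀]
    exact Nat.le_of_dvd (Nat.mul_pos Nat.card_pos Nat.card_pos) hcount
  have hvm : (PowerSeries.constantCoeff lam).valuation + ν ≤ m := by
    have h1 : padicValNat p idx = m := by rw [hm, padicValNat.prime_pow]
    have h2 : padicValNat p n = ν := by rw [hν, padicValNat.prime_pow]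
    omega
  -- the ledger times `p^{tp}`, then substitute the count and the hull bound
  set a := p ^ padicValNat p W.tamagawaProduct * Nat.card (AddCommGroup.primaryComponent (↥W.sha) p) with ha
  set b := p ^ padicValNat p ((W.baseChange ((primePlace p).adicCompletion ℚ)).localTamagawaNumber
      ((primePlace p).adicCompletionIntegers ℚ)) * p ^ e * (p ^ padicValNat p W.torsionOrder) ^ 2 with hb'
  have h1 : a * idx ≤ b * cS := by
    calc a * idx = p ^ padicValNat p W.tamagawaProduct * Nat.card (AddCommGroup.primaryComponent (↥W.sha) p) * idx := by rw [ha]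
      _ ≤ _ := h58
      _ = b * cS := by rw [hb']; ring
  have h2 : a * p ^ ((PowerSeries.constantCoeff lam).valuation + ν) * p ^ tp ≤ b * (p ^ ν * p ^ t₀) := by
    calc a * p ^ ((PowerSeries.constantCoeff lam).valuation + ν) * p ^ tp ≤ a * idx * p ^ tp := by
          refine Nat.mul_le_mul_right _ (Nat.mul_le_mul_left a ?_)
          rw [hm]; exact Nat.pow_le_pow_right hpp.pos hvm
      _ ≤ b * cS * p ^ tp := Nat.mul_le_mul_right _ h1
      _ = b * (cS * p ^ tp) := by ring
      _ ≤ b * (p ^ ν * p ^ t₀) := Nat.mul_le_mul_left b hcount'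
  have h3 : a * p ^ ((PowerSeries.constantCoeff lam).valuation) * p ^ tp ≤ b * p ^ t₀ := by
    have : a * p ^ ((PowerSeries.constantCoeff lam).valuation) * p ^ tp * p ^ ν ≤ b * p ^ t₀ * p ^ ν := by
      calc a * p ^ ((PowerSeries.constantCoeff lam).valuation) * p ^ tp * p ^ ν
          = a * p ^ ((PowerSeries.constantCoeff lam).valuation + ν) * p ^ tp := by rw [pow_add]; ring
        _ ≤ b * (p ^ ν * p ^ t₀) := h2
        _ = b * p ^ t₀ * p ^ ν := by ring
    exact Nat.le_of_mul_le_mul_right this (pow_pos hpp.pos ν)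
  have h4' : p ^ (padicValNat p W.tamagawaProduct + s + (PowerSeries.constantCoeff lam).valuation + tp) ≤
      p ^ (e + padicValNat p ((W.baseChange ((primePlace p).adicCompletion ℚ)).localTamagawaNumber
          ((primePlace p).adicCompletionIntegers ℚ)) + 2 * padicValNat p W.torsionOrder + t₀) := by
    calc p ^ (padicValNat p W.tamagawaProduct + s + (PowerSeries.constantCoeff lam).valuation + tp)
        = a * p ^ ((PowerSeries.constantCoeff lam).valuation) * p ^ tp := by rw [ha, hs, pow_add, pow_add, pow_add]
      _ ≤ b * p ^ t₀ := h3
      _ = _ := by rw [hb', ← pow_mul, ← pow_add, ← pow_add, ← pow_add]; ring_nf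
  have h5 := (Nat.pow_le_pow_iff_right hpp.one_lt).mp h4'
  have hTpv : padicValNat p (Nat.card (AddCommGroup.primaryComponent
      (W.baseChange ((primePlace p).adicCompletion ℚ)).toAffine.Point p)) = tp := by rw [htp, padicValNat.prime_pow]
  have hT0v : padicValNat p (Nat.card (AddCommGroup.primaryComponent W.toAffine.Point p)) = t₀ := by
    rw [ht₀, padicValNat.prime_pow]
  rw [hs, padicValNat.prime_pow, hTpv, hT0v]
  omega

/-- **NORMAL FORM ⟹ crux M's printed inequality AT `W` on every reducible row.**  Same data; with 27962's exponent
`e = ord_p q + v_p(λ(0)) + t_p − v_p(c_p)` (`L(W,1)/Ω(W) = q`): **`ord_p #Ш(W)[p^∞] + v_p(Tam W) ≤ ord_p q + 2·v_p #W(ℚ)_tors + t₀`** and,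
since `t₀ = ord_p #W(ℚ)[p^∞] ≤ v_p #W(ℚ)_tors`, **`≤ ord_p q + 3·v_p #W(ℚ)_tors`** — the conclusion of `O6.KatoMemberShaBoundOfReducible` at `W`.
[cite: Kato2004Asterisque, Thm. 12.5 (1) (p. 221), Lemma 13.10 (1) (p. 230), (14.9.3) (p. 240), (14.14.2) (p. 243), Prop. 14.16 (2) (pp. 244–245), Lemma 14.18 (pp. 247–248)]
[cite: Kim2022StructureSelmer, §3.2.3 display before Thm. 3.7 (PDF p. 16)] -/
theorem padicValNat_sha_add_tamagawa_le_three_mul_of_zetaLineOrthIndexAt_normalForm_of_hull_of_countDvd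
    (hLim : Lim2017.thm35_fineSelmerDual_moduleFinite_of_classicalMuVanishes_of_le_divisionField)
    (hFW : Literature.NumberTheory.IwasawaTheory.ferreroWashington1979_classicalMuVanishes)
    (hp : p ≠ 2) (hκ : κ.IsCyclotomic) (hγ : κ.IsTopGenerator γ) (hred : ¬ W.HasIrreducibleModPGaloisRep p)
    (I : IwasawaH1Data W p κ γ) (J : IwasawaH2Data W p κ γ I)
    (eX : (W.fineSelmerDualData κ hγ).X →ₗ[IwasawaAlgebra p] J.H2) (heX : Function.Injective eX)
    (hcokX : Finite (J.H2 ⧸ LinearMap.range eX))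
    (hcount : Nat.card (katoStrictSelmer W p {primePlace p}) *
        Nat.card (AddCommGroup.primaryComponent (W.baseChange ((primePlace p).adicCompletion ℚ)).toAffine.Point p) ∣
      Nat.card (coinvariants p J.H2) * Nat.card (AddCommGroup.primaryComponent W.toAffine.Point p))
    {F : Type} [AddCommGroup F] [Module (IwasawaAlgebra p) F] [Module.Finite (IwasawaAlgebra p) F]
    [NoZeroSMulDivisors (IwasawaAlgebra p) F]
    (j : I.H →ₗ[IwasawaAlgebra p] F) (hj : Function.Injective j) (hcok : Finite (F ⧸ LinearMap.range j))
    (z : F) (hz : z ≠ 0) (hFZ : Module.IsTorsion (IwasawaAlgebra p) (F ⧸ (IwasawaAlgebra p) ∙ z))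
    (hdiv : ∀ 𝔮 : PrimeSpectrum (IwasawaAlgebra p), 𝔮.asIdeal.height = 1 → 𝔮.asIdeal ≠ augIdealP p →
      Module.lengthAt (IwasawaAlgebra p) (W.fineSelmerDualData κ hγ).X 𝔮 ≤
        Module.lengthAt (IwasawaAlgebra p) (F ⧸ (IwasawaAlgebra p) ∙ z) 𝔮)
    (y : I.H) (lam : IwasawaAlgebra p) (hlam : PowerSeries.constantCoeff lam ≠ 0) (hjy : j y = lam • z)
    (hnt : ¬ IsOfFinAddOrder (I.proj 0 y)) {q : ℚ} {e : ℕ}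
    (he : (e : ℤ) = padicValRat p q + ((PowerSeries.constantCoeff lam).valuation : ℤ) +
        (padicValNat p (Nat.card (AddCommGroup.primaryComponent
          (W.baseChange ((primePlace p).adicCompletion ℚ)).toAffine.Point p)) : ℤ) -
        (padicValNat p ((W.baseChange ((primePlace p).adicCompletion ℚ)).localTamagawaNumber
          ((primePlace p).adicCompletionIntegers ℚ)) : ℤ))
    (hb : ZetaLineOrthIndexAt W p (layerZeroToTop W p κ (I.proj 0 y)) e) :
    (padicValNat p (Nat.card (AddCommGroup.primaryComponent W.sha p)) : ℤ) + padicValNat p W.tamagawaProduct ≤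
        padicValRat p q + 2 * (padicValNat p W.torsionOrder : ℤ) +
          padicValNat p (Nat.card (AddCommGroup.primaryComponent W.toAffine.Point p)) ∧
      (padicValNat p (Nat.card (AddCommGroup.primaryComponent W.sha p)) : ℤ) + padicValNat p W.tamagawaProduct ≤
        padicValRat p q + 3 * (padicValNat p W.torsionOrder : ℤ) := by
  have hpp : p.Prime := Fact.out
  have h := padicValNat_sha_add_tamagawa_add_valuation_le_of_zetaLineOrthIndexAt_of_hull_of_countDvd W p hLim hFW hp hκ hγ hred I J eX heX
    hcokX hcount j hj hcok z hz hFZ hdiv y lam hlam hjy hnt e hb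
  -- `t₀ ≤ v_p #W(ℚ)_tors`
  have htO : Nat.card (AddCommGroup.torsion W.toAffine.Point) = W.torsionOrder := by
    unfold WeierstrassCurve.torsionOrder; convert rfl
  have ht₀le : padicValNat p (Nat.card (AddCommGroup.primaryComponent W.toAffine.Point p)) ≤ padicValNat p W.torsionOrder := by
    have hdvd : Nat.card (AddCommGroup.primaryComponent W.toAffine.Point p) ∣ Nat.card (AddCommGroup.torsion W.toAffine.Point) :=
      AddSubgroup.card_dvd_of_le fun x hx => by
        obtain ⟨k, hk⟩ := (AddCommGroup.mem_primaryComponent (p := p)).mp hx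
        rw [AddCommGroup.mem_torsion]
        exact isOfFinAddOrder_iff_nsmul_eq_zero.mpr ⟨p ^ k, pow_pos hpp.pos k, hk⟩
    rw [htO] at hdvd
    exact (padicValNat_dvd_iff_le (htO ▸ Nat.card_pos.ne')).mp (dvd_trans pow_padicValNat_dvd hdvd)
  have h' : ((padicValNat p (Nat.card (AddCommGroup.primaryComponent W.sha p)) : ℕ) : ℤ) +
      (padicValNat p W.tamagawaProduct : ℤ) + ((PowerSeries.constantCoeff lam).valuation : ℤ) +
      (padicValNat p (Nat.card (AddCommGroup.primaryComponent (W.baseChange ((primePlace p).adicCompletion ℚ)).toAffine.Point p)) : ℤ) ≤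
      (e : ℤ) + (padicValNat p ((W.baseChange ((primePlace p).adicCompletion ℚ)).localTamagawaNumber
          ((primePlace p).adicCompletionIntegers ℚ)) : ℤ) + 2 * (padicValNat p W.torsionOrder : ℤ) +
        (padicValNat p (Nat.card (AddCommGroup.primaryComponent W.toAffine.Point p)) : ℤ) := by
    exact_mod_cast h
  have ht₀le' : ((padicValNat p (Nat.card (AddCommGroup.primaryComponent W.toAffine.Point p)) : ℕ) : ℤ) ≤
      (padicValNat p W.torsionOrder : ℤ) := by exact_mod_cast ht₀le
  constructor <;> linarith

end Count

/-! ## §9 On the rows with `W(ℚ_p)[p] = 0` the one-sided count is kernel (the prequels are special cases) -/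

section TameCount

variable (W : WeierstrassCurve ℚ) [W.IsElliptic] (p : ℕ) [Fact p.Prime]
  [ContinuousSMul ℤ_[p] (W.tateModule p)]
  {κ : ZpExtension ℚ p} {γ : absoluteGaloisGroup ℚ}

/-- **The one-sided count for ANY `J ⊇ X₀` of finite cokernel on a row with `W(ℚ_p)[p] = 0`** (`p ≠ 2`, `(κ,γ)` cyclotomic, `(X₀)_Γ` finite):
`#Sel_str · #W(ℚ_v)[p^∞] ∣ #(J.H2)_Γ · #W(ℚ)[p^∞]` — both point groups are trivial (g26/g27), `#Sel_str = #(X₀)_Γ` (exact control) and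
`ord #(X₀)_Γ ≤ ord #(J.H2)_Γ` with both powers of `p` (the prequel's §1).
[cite: Kato2004Asterisque, (14.9.1)–(14.9.3) (pp. 239–240), (14.14.2) (p. 243)] [cite: GreenbergLNM1716, §4 Lemma 4.2 (p. 102)] -/
theorem countDvd_of_noPTorsionPadic (hp : p ≠ 2) (hκ : κ.IsCyclotomic) (hγ : κ.IsTopGenerator γ)
    (h4 : ∀ R : (W.baseChange ℚ_[p]).toAffine.Point, p • R = 0 → R = 0)
    (I : IwasawaH1Data W p κ γ) (J : IwasawaH2Data W p κ γ I)
    (eX : (W.fineSelmerDualData κ hγ).X →ₗ[IwasawaAlgebra p] J.H2) (heX : Function.Injective eX)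
    (hcokX : Finite (J.H2 ⧸ LinearMap.range eX)) (hfinX : Finite (coinvariants p (W.fineSelmerDualData κ hγ).X)) :
    Nat.card (katoStrictSelmer W p {primePlace p}) *
        Nat.card (AddCommGroup.primaryComponent (W.baseChange ((primePlace p).adicCompletion ℚ)).toAffine.Point p) ∣
      Nat.card (coinvariants p J.H2) * Nat.card (AddCommGroup.primaryComponent W.toAffine.Point p) := by
  rw [ExactFineControl.natCard_primaryComponent_point_adicCompletion_eq_one_of_noPTorsionPadic W h4,
    ExactFineControl.natCard_primaryComponent_point_eq_one_of_noPTorsionPadic W h4, mul_one, mul_one,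
    ← ExactFineControl.natCard_coinvariants_fineSelmerDual_eq_natCard_katoStrictSelmer W κ hp hκ hγ h4 (W.fineSelmerDualData κ hγ)]
  obtain ⟨-, hfinJ, hle⟩ := finite_coinvariants_and_padicValNat_le_of_embedding J eX heX hcokX hfinX
  haveI := hfinJ; haveI := hfinX
  obtain ⟨k, hk⟩ := MemberHullZetaInputsOfCore.natCard_eq_prime_pow_of_finite_module p (IwasawaAlgebra p)
    (coinvariants p (W.fineSelmerDualData κ hγ).X)
  obtain ⟨ν, hν⟩ := MemberHullZetaInputsOfCore.natCard_eq_prime_pow_of_finite_module p (IwasawaAlgebra p) (coinvariants p J.H2)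
  rw [hk, hν] at hle ⊢
  rw [padicValNat.prime_pow, padicValNat.prime_pow] at hle
  exact pow_dvd_pow p hle

end TameCount

end Summit.BirchSwinnertonDyer.BirchSwinnertonDyer.Theorems.ReducibleHullDescentCount

end
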